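import Literature.Combinatorics.Sahi2008.ProductOfChains
import Summits.CriticalPhenomena.PercolationContinuityZ3.Theorems.PercNearOneGluingNoHeavyLowerTailSahiGridConjectureIff

/-!
# `NoHeavyLowerTail` (crux stmt-CriticalPhenomena-4575), Sahi programme P1: the width stratification in UNIFORM form —
# layer `d` of Sahi's conjecture ⟺ the uniform weight on every discrete box `[M]^d`

Support file (Sahi cell, seat `prim-sahi-p1`, generation 3; `--supports stmt-CriticalPhenomena-4575`).

`…SahiWidthStratification` showed, for each dimension `d` and order `n`, that `E_n ≥ 0` for all PRODUCT probability
weights on the grids `[K+1]^d` (`P(d,n)`) is equivalent to `E_n ≥ 0` for all FKG probability weights on the grids `[b+1]^d`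
(and hence on every lattice of J-width `≤ d`).  Here the product layer is reduced further to the UNIFORM weight
(Lieb–Sahi's own setting, [LiebSahi2021, Conj. 1.1]: Lebesgue measure on `[0,1]^d`, discretised):

* `liebSahi_grid_iff_uniform d n`: `P(d,n) ⟺ U(d,n)`, where `U(d,n)`: for every `M ≥ 1` the uniform probability weight
  on `[M]^d = (Fin d → Fin M)` satisfies `E_n ≥ 0` for all nonnegative monotone families.  (Rational product weights are
  monotone images of uniform boxes under coordinatewise block maps — [LiebSahi2021, Lemma 2.3] in `d` dimensions, tree
  `ProductChains.blockMap` — and `E_n` is continuous in the weight.)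
* `fkg_grid_iff_uniform d n`: `U(d,n) ⟺` every FKG probability weight on every `[b+1]^d` satisfies `E_n ≥ 0`.
* `sahiConjecture_iff_forall_uniformGrid n`: `SahiConjecture n ⟺ ∀ d, U(d,n)` (compare the tree's cube form
  `sahiConjecture_iff_forall_uniformWeight_fin`, which is the sub-family `M = 2`, all `d`).

So THE FIRST OPEN CASE of Sahi's Conjecture 5 in the width stratification is literally: `E_n ≥ 0` (first `n = 3`) for
monotone functions on the uniform discrete cube `[M]³`, all `M` — e.g. for up-sets `A, B, C ⊆ [M]³`,
`2M⁶|ABC| + |A||B||C| ≥ M³(|A||BC| + |B||AC| + |C||AB|)` (checked exhaustively for all boxes with `≤ 36` points, this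
programme's census).  New mathematics (the organisation), standard ingredients.
-/

namespace Summit.CriticalPhenomena.PercolationContinuityZ3.Theorems.SahiWidth

open Finset Function Filter Topology Literature.Combinatorics.Sahi2008 ProductChains
open scoped BigOperators

noncomputable section

variable {d : ℕ}

/-! ## Block maps in `d` dimensions -/

section Block

variable {K M : ℕ}

/-- **Fibres of the coordinatewise block map**: the number of points of `[M]^d` mapped to `u ∈ [K+1]^d` is `∏_i k_i(u_i)`.
[cite: LiebSahi2021, Lemma 2.3 (§2)] -/
theorem card_filter_blockMapPi (k : Fin d → Fin (K + 1) → ℕ) (hk : ∀ i, ∑ v, k i v = M) (u : Fin d → Fin (K + 1)) :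
    (univ.filter fun ω : Fin d → Fin M => (fun i => blockMap (k i) (hk i) (ω i)) = u).card = ∏ i, k i (u i) := by
  classical
  have hset : (univ.filter fun ω : Fin d → Fin M => (fun i => blockMap (k i) (hk i) (ω i)) = u) =
      Fintype.piFinset fun i => univ.filter fun t : Fin M => blockMap (k i) (hk i) t = u i := by
    ext ω
    simp only [mem_filter, mem_univ, true_and, Fintype.mem_piFinset, funext_iff]
  rw [hset, Fintype.card_piFinset]
  exact prod_congr rfl fun i _ => card_blockMap_fibre (k i) (hk i) (u i)

/-- **The uniform box `[M]^d` pushes forward to the rational product weight `∏_i k_i(u_i)/M`** along the coordinatewise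
block map. [cite: LiebSahi2021, Lemma 2.3 (§2)] -/
theorem pushWeight_uniform_blockMapPi (k : Fin d → Fin (K + 1) → ℕ) (hk : ∀ i, ∑ v, k i v = M) :
    pushWeight (fun _ : Fin d → Fin M => (1 : ℝ) / (M : ℝ) ^ d) (fun ω i => blockMap (k i) (hk i) (ω i)) =
      fun u : Fin d → Fin (K + 1) => ∏ i, ((k i (u i) : ℝ) / M) := by
  classical
  funext u
  rw [pushWeight_apply]
  rw [show (∑ ω : Fin d → Fin M, if (fun i => blockMap (k i) (hk i) (ω i)) = u then (1 : ℝ) / (M : ℝ) ^ d else 0) =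
      (1 : ℝ) / (M : ℝ) ^ d * ∑ ω : Fin d → Fin M, if (fun i => blockMap (k i) (hk i) (ω i)) = u then (1 : ℝ) else 0 by
    rw [mul_sum]
    exact sum_congr rfl fun ω _ => by split_ifs <;> simp]
  rw [sum_boole, card_filter_blockMapPi k hk u, prod_div_distrib, prod_const, card_univ, Fintype.card_fin]
  push_cast
  ring

/-- **Rational product weights are monotone images of uniform boxes**: under `U(d,n)` at `M ≥ 1`, the product weight
`∏_i k_i(u_i)/M` on `[K+1]^d` (compositions `k_i` of `M`) satisfies Sahi's `E_n ≥ 0`. [this work] -/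
theorem sahiPositive_gridProd_rat {n : ℕ} (hU : ∀ M, 0 < M → SahiPositive (fun _ : Fin d → Fin M => (1 : ℝ) / (M : ℝ) ^ d) n)
    (k : Fin d → Fin (K + 1) → ℕ) (hM : 0 < M) (hk : ∀ i, ∑ v, k i v = M) :
    SahiPositive (fun u : Fin d → Fin (K + 1) => ∏ i, ((k i (u i) : ℝ) / M)) n := by
  rw [← pushWeight_uniform_blockMapPi k hk]
  exact (hU M hM).of_pushWeight fun ω ω' h i => blockMap_mono (k i) (hk i) (h i)

end Block

/-! ## The limit: every product weight -/

section Limit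

/-- The grid product weight is continuous in the family of coordinate weights. [folklore] -/
theorem continuous_gridProd {K : ℕ} :
    Continuous fun v : Fin d → Fin (K + 1) → ℝ => fun ω : Fin d → Fin (K + 1) => ∏ i, v i (ω i) :=
  continuous_pi fun ω => continuous_finsetProd _ fun i _ => (continuous_apply (ω i)).comp (continuous_apply i)

/-- **`U(d,n) ⇒ P(d,n)`**: if the uniform weight on every box `[M]^d` satisfies Sahi's `E_n ≥ 0`, so does every product
probability weight on every grid `[K+1]^d` (rational weights by block maps, the rest by continuity of `E_n` in the
weight, `BHK2006.continuous_sahiE`, with the approximations `⌊g M⌋/M` of `ProductChains.approx`). [this work] -/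
theorem sahiPositive_gridProd_of_uniform {n : ℕ}
    (hU : ∀ M, 0 < M → SahiPositive (fun _ : Fin d → Fin M => (1 : ℝ) / (M : ℝ) ^ d) n)
    (K : ℕ) (g : Fin d → Fin (K + 1) → ℝ) (hg0 : ∀ i u, 0 ≤ g i u) (hg1 : ∀ i, ∑ u, g i u = 1) :
    SahiPositive (fun ω : Fin d → Fin (K + 1) => ∏ i, g i (ω i)) n := by
  intro f hf hmono
  have hcont : Continuous fun v : Fin d → Fin (K + 1) → ℝ =>
      sahiE (fun ω : Fin d → Fin (K + 1) => ∏ i, v i (ω i)) n f :=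
    (Literature.Probability.Percolation.BHK2006.continuous_sahiE n f).comp continuous_gridProd
  have hlim : Tendsto (fun M : ℕ => fun i u => (approx (g i) M u : ℝ) / M) atTop (𝓝 g) :=
    tendsto_pi_nhds.2 fun i => tendsto_pi_nhds.2 fun u => tendsto_approx_div (g i) (hg0 i) (hg1 i) u
  refine ge_of_tendsto ((hcont.tendsto g).comp hlim) ?_
  filter_upwards [eventually_ge_atTop 1] with M hM
  exact sahiPositive_gridProd_rat hU (fun i => approx (g i) M) hM (fun i => sum_approx (g i) (hg0 i) (hg1 i) M)
    f hf hmono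

/-- **`P(d,n) ⟺ U(d,n)`**: Sahi's `E_n ≥ 0` for all product probability weights on the grids `[K+1]^d` is equivalent to
the same for the UNIFORM weight on the boxes `[M]^d`, `M ≥ 1`. [this work] -/
theorem liebSahi_grid_iff_uniform (d n : ℕ) :
    (∀ (K : ℕ) (g : Fin d → Fin (K + 1) → ℝ), (∀ i u, 0 ≤ g i u) → (∀ i, ∑ u, g i u = 1) →
      SahiPositive (fun ω : Fin d → Fin (K + 1) => ∏ i, g i (ω i)) n) ↔
    ∀ M, 0 < M → SahiPositive (fun _ : Fin d → Fin M => (1 : ℝ) / (M : ℝ) ^ d) n := by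
  constructor
  · intro hP M hM
    obtain ⟨K, rfl⟩ : ∃ K, M = K + 1 := Nat.exists_eq_succ_of_ne_zero hM.ne'
    have h := hP K (fun _ _ => (1 : ℝ) / (K + 1 : ℕ)) (fun _ _ => by positivity)
      (fun _ => by rw [sum_const, card_univ, Fintype.card_fin, nsmul_eq_mul]; field_simp)
    have heq : (fun ω : Fin d → Fin (K + 1) => ∏ _i : Fin d, (1 : ℝ) / ((K + 1 : ℕ) : ℝ)) =
        fun _ => (1 : ℝ) / ((K + 1 : ℕ) : ℝ) ^ d := by
      funext ω
      rw [prod_const, card_univ, Fintype.card_fin, one_div_pow]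
    rw [heq] at h
    exact h
  · intro hU K g hg0 hg1
    exact sahiPositive_gridProd_of_uniform hU K g hg0 hg1

/-- **`U(d,n) ⟺ W(d,n)`**: the uniform weight on every box `[M]^d` satisfies Sahi's `E_n ≥ 0` if and only if every FKG
probability weight on every grid `[b+1]^d` does (hence every FKG weight on every lattice of J-width `≤ d`,
`sahiPositive_of_latticeEmbedding_grid`). [this work] -/
theorem fkg_grid_iff_uniform (d n : ℕ) :
    (∀ M, 0 < M → SahiPositive (fun _ : Fin d → Fin M => (1 : ℝ) / (M : ℝ) ^ d) n) ↔
      ∀ (b : ℕ) (μ : (Fin d → Fin (b + 1)) → ℝ), IsFKGMeasure μ → SahiPositive μ n := by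
  rw [← liebSahi_grid_iff_uniform, liebSahi_grid_iff_fkg_grid]

/-- **Sahi's conjecture at order `n` ⟺ the uniform boxes**: `SahiConjecture n` holds if and only if for every dimension
`d` and every `M ≥ 1` the uniform probability weight on `[M]^d` satisfies `E_n ≥ 0` for all nonnegative monotone families
(the tree's `sahiConjecture_iff_forall_uniformWeight_fin` is the sub-family of cubes `M = 2`). [this work] -/
theorem sahiConjecture_iff_forall_uniformGrid (n : ℕ) :
    SahiConjecture n ↔ ∀ (d M : ℕ), 0 < M → SahiPositive (fun _ : Fin d → Fin M => (1 : ℝ) / (M : ℝ) ^ d) n := by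
  rw [sahiConjecture_iff_forall_grid]
  exact ⟨fun h d => (liebSahi_grid_iff_uniform d n).1 (h d), fun h d => (liebSahi_grid_iff_uniform d n).2 (h d)⟩

end Limit

end

end Summit.CriticalPhenomena.PercolationContinuityZ3.Theorems.SahiWidth
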